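import Mathlib
import HarnessLib
import Summits.ResolutionOfSingularities.ResolutionOfSingularities.Theorems.WildQuotientsWildQuotientResolutionPGroupEigenline
import Summits.ResolutionOfSingularities.ResolutionOfSingularities.Theorems.WildQuotientsWildQuotientResolutionCommonEigenvector

/-!
# The p-CLOSED eigenline (Kollár–Szabó Lemma A.1 shape): a group with a normal `p`-subgroup and commutative
# quotient, acting on a local ring of residue characteristic `p` with algebraically closed residue field,
# stabilises a tangent hyperplane (crux `WildQuotients.WildQuotientResolution`, stub `stub_phaseZeroHighDim`)

Crux stmt-ResolutionOfSingularities-15640 (`WildQuotientResolution`), registered stub `stub_phaseZeroHighDim`;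
programme PHASE0-KS-EIGENLINE. The stub's target inertia groups are p-CLOSED (`HasNormalSylow`: `I = P ⋊ C` with
`P` the normal Sylow `p`-subgroup and `C` abelian, tame). Kollár–Szabó's Lemma A.1: a linear algebraic group with a
normal unipotent subgroup and abelian quotient has an eigenvector in every representation. Finite version in
characteristic `p`, as needed by the blow-up fixed-point chain (✓`KSBlowupEquivariantChartOfHyperplane`,
✓`KSBlowupFixedPointWild`):

* `exists_common_eigencovector_of_normal_isPGroup` — for a finite group `G`, a NORMAL subgroup `P` which is a
  `p`-group with all commutators of `G` in `P`, acting `k`-linearly (`char k = p`, `k` algebraically closed) on a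
  non-zero finite-dimensional `V`: a non-zero covector `l` with `l ∘ ρ_g = μ_g • l` for every `g` (the `P`-fixed
  covectors ✓`PGroupEigenline.exists_ne_zero_fixed_of_isPGroup` form a non-zero `G`-stable subspace on which `G`
  acts through the abelian `G/P`, ✓`CommonEigenvector.exists_common_eigenvector_of_commute`);
* `exists_stable_tangentHyperplane_of_eigencovector` — the hyperplane package from ANY eigen-covector of the
  cotangent representation (the common core of ✓`AbelianEigenline.exists_stable_tangentHyperplane` and
  ✓`PGroupEigenline.exists_stable_tangentHyperplane_of_isPGroup`);
* `exists_stable_tangentHyperplane_of_normal_isPGroup` — **the stable tangent hyperplane for a residue-trivial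
  action of a p-closed finite group `G ⊵ P`, `[G,G] ≤ P`, on a Noetherian local ring with algebraically closed
  residue field of characteristic `p`.**

[OURS · crux stmt-ResolutionOfSingularities-15640 · helper toward `stub_phaseZeroHighDim` (p-closed eigenline for the
Kollár–Szabó blow-up step; NOT a proof of the stub); folklore, counted 0; AI-level work, weaker than expert review.]
[cite: ReichsteinYoussin2000, Appendix (Kollár–Szabó), Lemma A.1]
-/

-- single-problem summit: the doubled namespace component `ResolutionOfSingularities` is forced
set_option linter.dupNamespace false

noncomputable section

namespace Summit.ResolutionOfSingularities.ResolutionOfSingularities.Theorems.WildQuotientResolution.PGroupEigenline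

open IsLocalRing Module
open Summit.ResolutionOfSingularities.ResolutionOfSingularities.Theorems.WildQuotientResolution

universe u v w

/-! ## Kollár–Szabó Lemma A.1, finite version in characteristic `p` -/

section LemmaA1

variable {k : Type u} [Field k] [IsAlgClosed k] {p : ℕ} [Fact p.Prime] [CharP k p]
variable {V : Type v} [AddCommGroup V] [Module k V] [FiniteDimensional k V] [Nontrivial V]
variable {G : Type w} [Group G] [Finite G]

/-- **Common eigen-covector for a group with a normal `p`-subgroup and commutative quotient** (Kollár–Szabó,
Lemma A.1, finite version in characteristic `p`): if `P ⊴ G` is a `p`-group containing all commutators and `G`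
acts `k`-linearly on `V ≠ 0` (`k` algebraically closed of characteristic `p`), some non-zero covector `l`
satisfies `l ∘ ρ_g = μ_g • l` for all `g`. [cite: ReichsteinYoussin2000, Appendix, Lemma A.1] -/
theorem exists_common_eigencovector_of_normal_isPGroup (P : Subgroup G) [hPn : P.Normal] (hP : IsPGroup p P)
    (hcomm : ∀ g h : G, g * h * g⁻¹ * h⁻¹ ∈ P) (ρ : G →* (V →ₗ[k] V)) :
    ∃ l : Module.Dual k V, l ≠ 0 ∧ ∀ g : G, ∃ μ : k, l ∘ₗ ρ g = μ • l := by
  classical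
  -- the contragredient action on the dual `W`
  let ρ' : G →* (Module.Dual k V →ₗ[k] Module.Dual k V) :=
    { toFun := fun g => (ρ g⁻¹).dualMap
      map_one' := by
        rw [inv_one, map_one]
        rfl
      map_mul' := fun a b => by
        rw [mul_inv_rev, map_mul]
        exact (LinearMap.dualMap_comp_dualMap (ρ a⁻¹) (ρ b⁻¹)).symm }
  have hρ' : ∀ g (l : Module.Dual k V), ρ' g l = l ∘ₗ ρ g⁻¹ := fun g l => rfl
  -- the `P`-fixed covectors `U`, a `G`-stable subspace
  let U : Submodule k (Module.Dual k V) := ⨅ q : P, LinearMap.ker (ρ' (q : G) - 1)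
  have memU : ∀ l, l ∈ U ↔ ∀ q : P, ρ' (q : G) l = l := by
    intro l
    simp only [U, Submodule.mem_iInf, LinearMap.mem_ker, LinearMap.sub_apply, Module.End.one_apply, sub_eq_zero]
  have hUst : ∀ g : G, ∀ l ∈ U, ρ' g l ∈ U := by
    intro g l hl
    rw [memU] at hl ⊢
    intro q
    have hq' : g⁻¹ * (q : G) * g⁻¹⁻¹ ∈ P := hPn.conj_mem _ q.2 g⁻¹
    have := hl ⟨_, hq'⟩
    simp only [inv_inv] at this
    calc ρ' (q : G) (ρ' g l) = ρ' g (ρ' (g⁻¹ * q * g) l) := by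
            rw [← Module.End.mul_apply, ← map_mul, ← Module.End.mul_apply, ← map_mul]
            congr 2; group
      _ = ρ' g l := by rw [this]
  -- `U ≠ 0`: the `p`-group `P` fixes a non-zero covector
  have hU0 : ∃ l ∈ U, l ≠ 0 := by
    obtain ⟨v, hv⟩ := exists_ne (0 : V)
    obtain ⟨l₀, hl₀⟩ : ∃ l₀ : Module.Dual k V, l₀ v ≠ 0 := by
      by_contra h
      simp only [not_exists, not_not] at h
      exact hv ((Module.forall_dual_apply_eq_zero_iff k v).mp h)
    have hl₀0 : l₀ ≠ 0 := fun h => hl₀ (by rw [h]; rfl)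
    obtain ⟨l, -, hl0, hl⟩ := exists_ne_zero_fixed_of_isPGroup hP (ρ'.comp P.subtype) hl₀0
    exact ⟨l, (memU l).mpr fun q => hl q, hl0⟩
  haveI : Nontrivial U := by
    obtain ⟨l, hlU, hl0⟩ := hU0
    exact ⟨⟨⟨l, hlU⟩, 0, fun h => hl0 (congrArg Subtype.val h)⟩⟩
  -- the restrictions to `U` commute
  let f : G → Module.End k U := fun g => (ρ' g).restrict (hUst g)
  have hf_apply : ∀ g (u : U), ((f g u : U) : Module.Dual k V) = ρ' g u := fun g u => rfl
  have hf : ∀ a b, Commute (f a) (f b) := by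
    intro a b
    change f a * f b = f b * f a
    apply LinearMap.ext
    intro u
    apply Subtype.ext
    change ρ' a (ρ' b u) = ρ' b (ρ' a u)
    have hc : ρ' (b * a) (u : Module.Dual k V) = ρ' (a * b) u := by
      have hmem := (memU u).mp u.2 ⟨_, hcomm b⁻¹ a⁻¹⟩
      -- `b⁻¹ a⁻¹ b a ∈ P` fixes `u`, so `ρ'(a b) u = ρ'(a b) (ρ'(b⁻¹a⁻¹ba) u) = ρ'(b a) u`
      calc ρ' (b * a) (u : Module.Dual k V)
          = ρ' (a * b) (ρ' (b⁻¹ * a⁻¹ * b⁻¹⁻¹ * a⁻¹⁻¹) u) := by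
              rw [← Module.End.mul_apply, ← map_mul]
              congr 2; group
        _ = ρ' (a * b) u := by rw [hmem]
    rw [← Module.End.mul_apply, ← map_mul, ← Module.End.mul_apply, ← map_mul, hc]
  -- a common eigenvector in `U`
  haveI : FiniteDimensional k U := inferInstance
  obtain ⟨u, hu0, hu⟩ := CommonEigenvector.exists_common_eigenvector_of_commute (K := k) (V := U) f hf
  refine ⟨(u : Module.Dual k V), fun h => hu0 (Subtype.ext h), fun g => ?_⟩
  obtain ⟨μ, hμ⟩ := hu g⁻¹
  refine ⟨μ, ?_⟩
  have := congrArg (fun x : U => (x : Module.Dual k V)) hμ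
  simp only [hf_apply, Submodule.coe_smul] at this
  rw [hρ', inv_inv] at this
  exact this

end LemmaA1

/-! ## The hyperplane from an eigen-covector of the cotangent representation -/

section Hyperplane

variable {A : Type*} [CommRing A] [IsLocalRing A] [IsNoetherianRing A]
variable {I : Type*} [Group I] (τ : I →* (A ≃+* A))
  (hres : ∀ (g : I) (a : A), τ g a - a ∈ maximalIdeal A)

include hres

omit [IsNoetherianRing A] in
/-- **Stable tangent hyperplane from an eigen-covector.** If the cotangent representation `φ` of a residue-trivial
action `τ` (✓`CotangentRep.exists_cotangentRep`) has a common eigen-covector `l ≠ 0` (`l ∘ φ_g = μ_g • l`), then the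
preimage `W` of `ker l` in `𝔪` is a `τ`-stable ideal with `𝔪² ≤ W ≤ 𝔪`, `W ≠ 𝔪`, `W + (t) = 𝔪` for `t ∉ W` (the
common core of the abelian and wild eigenlines). [folklore] -/
theorem exists_stable_tangentHyperplane_of_eigencovector
    (φ : I →* (CotangentSpace A ≃ₗ[ResidueField A] CotangentSpace A))
    (hφ : ∀ (g : I) (x : maximalIdeal A), φ g ((maximalIdeal A).toCotangent x) =
      (maximalIdeal A).toCotangent ⟨τ g x, CotangentRep.maximalIdeal_le_comap (τ g) (hres g) x.2⟩)
    (l : Module.Dual (ResidueField A) (CotangentSpace A)) (hl : l ≠ 0)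
    (hel : ∀ g : I, ∃ μ : ResidueField A, l ∘ₗ (φ g : CotangentSpace A →ₗ[ResidueField A] CotangentSpace A) = μ • l) :
    ∃ W : Ideal A, maximalIdeal A ^ 2 ≤ W ∧ W ≤ maximalIdeal A ∧ W ≠ maximalIdeal A ∧
      (∀ t ∈ maximalIdeal A, t ∉ W → W ⊔ Ideal.span {t} = maximalIdeal A) ∧
      ∀ g : I, ∀ w ∈ W, τ g w ∈ W := by
  -- `W` = the preimage in `𝔪` of the hyperplane `ker λ ⊆ 𝔪/𝔪²`
  let Wm : Submodule A (maximalIdeal A) :=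
    ((LinearMap.ker l).restrictScalars A).comap (maximalIdeal A).toCotangent
  let W : Ideal A := Wm.map (maximalIdeal A).subtype
  have memW : ∀ a : A, a ∈ W ↔ ∃ h : a ∈ maximalIdeal A, l ((maximalIdeal A).toCotangent ⟨a, h⟩) = 0 := by
    intro a
    constructor
    · rintro ⟨y, hy, rfl⟩
      exact ⟨y.2, by simpa [Wm] using hy⟩
    · rintro ⟨h, hl0⟩
      exact ⟨⟨a, h⟩, by simpa [Wm] using hl0, rfl⟩
  have hWle : W ≤ maximalIdeal A := fun a ha => by
    obtain ⟨h, -⟩ := (memW a).mp ha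
    exact h
  refine ⟨W, ?_, hWle, ?_, ?_, ?_⟩
  · intro a ha
    have ham : a ∈ maximalIdeal A := Ideal.pow_le_self two_ne_zero ha
    refine (memW a).mpr ⟨ham, ?_⟩
    rw [(Ideal.toCotangent_eq_zero (maximalIdeal A) ⟨a, ham⟩).mpr ha, map_zero]
  · intro hWeq
    apply hl
    apply LinearMap.ext
    intro v
    obtain ⟨x, rfl⟩ := (maximalIdeal A).toCotangent_surjective v
    have hxW : (x : A) ∈ W := by rw [hWeq]; exact x.2
    obtain ⟨h, h0⟩ := (memW x).mp hxW
    simpa using h0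
  · intro t ht htW
    have hlt : l ((maximalIdeal A).toCotangent ⟨t, ht⟩) ≠ 0 := fun h0 => htW ((memW t).mpr ⟨ht, h0⟩)
    apply le_antisymm (sup_le hWle ((Ideal.span_singleton_le_iff_mem _).mpr ht))
    intro a ha
    obtain ⟨b, hb⟩ := IsLocalRing.residue_surjective
      (l ((maximalIdeal A).toCotangent ⟨a, ha⟩) / l ((maximalIdeal A).toCotangent ⟨t, ht⟩))
    have habt : a - b * t ∈ maximalIdeal A :=
      sub_mem ha (Ideal.mul_mem_left _ b ht)
    have hW' : a - b * t ∈ W := by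
      refine (memW _).mpr ⟨habt, ?_⟩
      have e : (⟨a - b * t, habt⟩ : maximalIdeal A) = ⟨a, ha⟩ - b • ⟨t, ht⟩ := by
        apply Subtype.ext
        simp
      rw [e, map_sub, ← AbelianEigenline.residue_smul_toCotangent, map_sub, LinearMap.map_smul, smul_eq_mul,
        hb, div_mul_cancel₀ _ hlt, sub_self]
    have e : a = (a - b * t) + b * t := by ring
    rw [e]
    exact Submodule.add_mem_sup hW' (Ideal.mul_mem_left _ b (Ideal.mem_span_singleton_self t))
  · intro g w hw
    obtain ⟨hwm, hw0⟩ := (memW w).mp hw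
    have hgw : τ g w ∈ maximalIdeal A := CotangentRep.maximalIdeal_le_comap (τ g) (hres g) hwm
    refine (memW _).mpr ⟨hgw, ?_⟩
    obtain ⟨μ, hμ⟩ := hel g
    have h1 := hφ g ⟨w, hwm⟩
    have h2 := congrArg (fun f => f ((maximalIdeal A).toCotangent ⟨w, hwm⟩)) hμ
    simp only [LinearMap.coe_comp, Function.comp_apply, LinearEquiv.coe_coe, LinearMap.smul_apply,
      smul_eq_mul] at h2
    rw [h1] at h2
    rw [h2, hw0, mul_zero]

/-- **Stable tangent hyperplane of a p-CLOSED stabiliser** (`G ⊵ P` a normal `p`-subgroup with commutative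
quotient — e.g. `P` the normal Sylow `p`-subgroup of an inertia group with cyclic tame quotient): for a
residue-trivial action on a Noetherian local ring, not a field, with ALGEBRAICALLY CLOSED residue field of
characteristic `p`, there is a stable `𝔪² ≤ W < 𝔪` of codimension one.
[cite: ReichsteinYoussin2000, Appendix, Lemma A.1 and proof of Prop. A.2] -/
theorem exists_stable_tangentHyperplane_of_normal_isPGroup [Finite I] {p : ℕ} [Fact p.Prime]
    [CharP (ResidueField A) p] [IsAlgClosed (ResidueField A)]
    (P : Subgroup I) [P.Normal] (hP : IsPGroup p P) (hcomm : ∀ g h : I, g * h * g⁻¹ * h⁻¹ ∈ P)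
    (hA : ¬ IsField A) :
    ∃ W : Ideal A, maximalIdeal A ^ 2 ≤ W ∧ W ≤ maximalIdeal A ∧ W ≠ maximalIdeal A ∧
      (∀ t ∈ maximalIdeal A, t ∉ W → W ⊔ Ideal.span {t} = maximalIdeal A) ∧
      ∀ g : I, ∀ w ∈ W, τ g w ∈ W := by
  haveI := AbelianEigenline.nontrivial_cotangentSpace (A := A) hA
  obtain ⟨φ, hφ⟩ := CotangentRep.exists_cotangentRep τ hres
  let ρ : I →* (CotangentSpace A →ₗ[ResidueField A] CotangentSpace A) :=
    (LinearEquiv.automorphismGroup.toLinearMapMonoidHom).comp φ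
  have hρ : ∀ g, ρ g = (φ g : CotangentSpace A →ₗ[ResidueField A] CotangentSpace A) := fun g => rfl
  obtain ⟨l, hl, hel⟩ := exists_common_eigencovector_of_normal_isPGroup P hP hcomm ρ
  exact exists_stable_tangentHyperplane_of_eigencovector τ hres φ hφ l hl (fun g => by rw [← hρ]; exact hel g)

end Hyperplane

end Summit.ResolutionOfSingularities.ResolutionOfSingularities.Theorems.WildQuotientResolution.PGroupEigenline

end
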